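import Literature.IUT.HodgeTheaters.PMBaseEllBridgeSymmetryIndependence
import Literature.IUT.HodgeTheaters.PMBaseBridgePropsProofs
import Literature.IUT.HodgeTheaters.PMBaseNegCompatSub

/-!
# [IUTchI] Prop 6.6 (i), (ii), (iii) `IsoTorsor` as SCHEMATA (FACT-LIST F-2018): kernel verdicts

S. Mochizuki, *Inter-universal Teichmüller theory I: construction of Hodge theaters*, §6, Proposition 6.6
(i), (ii), (iii) p. 165 and Proposition 6.8 (i) pp. 167–168 of the kurims manuscript (May 2020)
[claim: Mochizuki2012, status: disputed].  PROOF-ONLY companion (theorems, no definitions) of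
abc-iut-L5-t4's `PMBaseBridgeProps.lean` (abc-iut cell, block F fact-proving wave, seat abc-iut-f-071 gen 3;
FACT-LIST row **F-2018** `IsoTorsor` — ONE row for the THREE same-named declarations
`DThetaPMBridge.IsoTorsor` (Prop 6.6 (i)), `DThetaEllBridge.IsoTorsor` (Prop 6.6 (ii)),
`DThetaPMEllHT.IsoTorsor` (Prop 6.6 (iii)); class `IUTch`, kernel_closedness `parametrised`).  Nothing of the
statement files is restated and no notion is declared; the three items are PREDICATES on ABSTRACT data
(a base kit `K : PMBaseKit l` — abc-iut-L5-t4's interface for the outputs of [IUTchI] Def 6.1 (ii)–(vii) —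
and two bridges / Hodge theaters over it).  Plan rule R1 for parametrised rows: decide the UNIVERSAL
CLOSURE; if false, file `not_forall_<decl>` and prove / cite the instance forms.

Kernel verdict, declaration by declaration (the heavy lifting is CITED BY NAME: abc-iut-w5-d199
`DThetaPMBridge.isoTorsor` (`PMBaseBridgePropsProofs`); abc-iut-L5-t13 `DThetaEllBridge.isoTorsor_injective`,
`isoTorsor_of_negCompat` (`PMBaseBridgePropsProofs4/5/9`, `PMBaseNegCompatProofs`); abc-iut-w5-d086
`Ex63.NegCompatModel`, `…_of_negCompatModel`, `negCompatModel_toyKit` (`PMBaseNegCompatSub`); abc-iut-L5-t7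
`DThetaPMEllHT.exists_kit_not_ellBridgeSymmetry` (`PMBaseEllBridgeSymmetryIndependence`)):

* **(i) `DThetaPMBridge.IsoTorsor`** — the universal closure HOLDS (`DThetaPMBridge.isoTorsor`, w5-d199):
  the FACT-LIST label «proved» is correct for this declaration and this declaration only.
* **(ii) `DThetaEllBridge.IsoTorsor`** — `DThetaEllBridge.not_forall_isoTorsor`: the universal closure is
  FALSE.  New link `DThetaPMEllHT.ellBridgeSymmetry_of_isoTorsor`: over EVERY kit, Prop 6.6 (ii) for the pair
  `(B, B)`, `B` the underlying `𝒟-Θ^{ell}`-bridge of a `𝒟-Θ^{±ell}`-Hodge theater, implies Prop 6.8 (i) for that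
  theater (transitivity is unconditional, `ellBridgeSymmetry_transitive`; the count `2·|T|` is the count of
  isomorphisms of `𝔽_l^±`-torsors, `FlPMTorsor.card_isIso`) — so abc-iut-L5-t7's two-place kit violating
  Prop 6.8 (i) violates Prop 6.6 (ii) (`DThetaEllBridge.exists_kit_not_isoTorsor`).  Instance forms PROVED:
  conditional over abstract data `DThetaEllBridge.isoTorsor_of_negCompatModel` (the `[−1]`-compatibility of
  `φ^{Θell}_{•,v}`, Example 6.3 (ii)); at abc-iut-L5-t4's consistency model `DThetaEllBridge.isoTorsor_toyKit`.
* **(iii) `DThetaPMEllHT.IsoTorsor`** — `DThetaPMEllHT.not_forall_isoTorsor`: FALSE universally, by the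
  sharper kit fact `DThetaPMEllHT.exists_kit_no_negative_ellIso` (over the same two-place kit the underlying
  `𝒟-Θ^{ell}`-bridge of the MODEL theater `(𝔇_≻ ⟵ 𝔇_± ⟶ 𝒟^{⊚±})` of Examples 6.2 (i) / 6.3 (i) admits NO
  automorphism whose index bijection is `t ↦ −t`; an automorphism of the theater with negative index bijection
  of `𝔽_l^±`-groups would hand one over, `DThetaPMEllHT.Iso.index_eq`).  Instance forms PROVED:
  `DThetaPMEllHT.isoTorsor_of_negCompatModel`, `DThetaPMEllHT.isoTorsor_toyKit`.

Consequence recorded for the branch-C certificates (`Summits/ABC/IUTFork/Conditional/Layer5OfS.lean`,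
`layer5_held_sec6`): the law binder `hβ : Ex63.NegCompatModel K` in front of the Prop 6.6 (ii)/(iii) conjuncts is
NOT removable by proof over the interface — the conjuncts are kernel-false for some kits — and must not be
replaced by the closed universal closures (kernel-false hypotheses).  Verdict conjunction:
`isoTorsor_schema_verdict`.

Refuting a universal closure over OUR interface `PMBaseKit` says nothing about the printed claim for the genuine
objects of [IUTchI] (where Example 6.3 (ii) supplies the `[−1]`-compatibility); nothing here takes a side on
[IUTchIII] Cor. 3.12 or asserts that abc is proved or refuted; typed ≠ proved; a FACT-LIST row is an assumption
label, proved/refuted = OUR kernel check only.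
-/

namespace Literature.IUT.HodgeTheaters

open CategoryTheory

universe u

namespace PMBaseKit

/-! ### Prop 6.6 (ii) for `(B, B)` implies Prop 6.8 (i) — over every kit -/

section Abstract

variable {l : ℕ} {K : PMBaseKit.{u} l}

/-- **[IUTchI] Prop 6.6 (ii) ⇒ Prop 6.8 (i)** (pp. 165, 167–168: "admits an `𝔽_l^{⋊±}`-symmetry … which acts
doubly transitively", read off "the set of isomorphisms between two `𝒟-Θ^{ell}`-bridges forms an
`𝔽_l^{⋊±}`-torsor … maps bijectively … to the set of isomorphisms of `𝔽_l^±`-torsors between the index sets"):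
if the automorphisms of the underlying `𝒟-Θ^{ell}`-bridge `B` of a `𝒟-Θ^{±ell}`-Hodge theater `H` correspond
bijectively to the isomorphisms of `𝔽_l^±`-torsors `T ⥲ T` (the named statement `DThetaEllBridge.IsoTorsor B B`),
then `H` has the `𝔽_l^{⋊±}`-symmetry `EllBridgeSymmetry H`: transitivity on `T` is unconditional
(`ellBridgeSymmetry_transitive`, the translations), and there are `2·l = 2·|T|` isomorphisms of
`𝔽_l^±`-torsors (`FlPMTorsor.card_isIso`).  Over every base kit, no side condition.
[claim: Mochizuki2012, status: disputed] -/
theorem DThetaPMEllHT.ellBridgeSymmetry_of_isoTorsor (H : K.DThetaPMEllHT)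
    (h : DThetaEllBridge.IsoTorsor H.ellBridge H.ellBridge) : DThetaPMEllHT.EllBridgeSymmetry H := by
  intro hV
  refine ⟨DThetaPMEllHT.ellBridgeSymmetry_transitive H, ?_⟩
  obtain ⟨-, hbij⟩ := h hV
  have hl2 : 2 < l := DThetaPMEllHT.two_lt_of_nonempty hV H
  have hS : Nat.card {ι : H.ellBridge.T ≃ H.ellBridge.T // H.ellBridge.torT.Compat H.ellBridge.torT ι} = 2 * l := by
    change Nat.card {f : H.ellBridge.T ≃ H.ellBridge.T //
      ∀ e' ∈ H.ellBridge.torT.charts, f.trans e' ∈ H.ellBridge.torT.charts} = _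
    exact H.ellBridge.torT.card_isIso H.ellBridge.torT hl2
  have hT : Nat.card H.T = l := by
    rw [Nat.card_congr H.grpT.chart₀, Nat.card_zmod]
  rw [Nat.card_congr (Equiv.ofBijective _ hbij), hS, hT]

end Abstract

/-! ### The two-place toy kit: no automorphism of the model `𝒟-Θ^{ell}`-bridge has index bijection `t ↦ −t` -/

/-- **Kit fact behind the independence of Prop 6.6 (ii), (iii) and Prop 6.8 (i).**  For every prime `l ≠ 2`
there is a base kit `K : PMBaseKit l` with TWO valuations — abc-iut-L5-t4's toy collage kit at each place, with
`φ^{Θell}_{•,v}` the identity of `AGL₁(𝔽_l)` at one place and the TRANSLATION `z ↦ z + 1` at the other, every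
interface clause holding (abc-iut-L5-t7's kit of `DThetaPMEllHT.exists_kit_not_ellBridgeSymmetry`, rebuilt
verbatim) — over which the underlying `𝒟-Θ^{ell}`-bridge of the MODEL `𝒟-Θ^{±ell}`-Hodge theater
`(𝔇_≻ ⟵ 𝔇_± ⟶ 𝒟^{⊚±})` of Examples 6.2 (i) / 6.3 (i) ([IUTchI] pp. 159–161; `Ex62.ht K`) admits NO automorphism
whose index bijection is the negation `t ↦ −t` of the `𝔽_l^±`-group `T = 𝔽_l`.  Mechanism (abc-iut-L5-t7's
Step 2): reading the compatibility square of such an automorphism on `±`-label classes of cusps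
(`DThetaEllBridge.Iso.zeta_trans_gLabMap`) at the labels `(t, v) = (0, transl)` and `(1, id)` makes the SAME
global constituent act on the cusp `1` as `1 ↦ 1` and as `1 ↦ −1`, i.e. `2 = 0` in `𝔽_l`.
[claim: Mochizuki2012, status: disputed] -/
theorem DThetaPMEllHT.exists_kit_no_negative_ellIso (l : ℕ) [Fact l.Prime] (hl : l ≠ 2) :
    ∃ K : PMBaseKit.{0} l, Nonempty K.V ∧ ∃ H : K.DThetaPMEllHT,
      ∀ g : DThetaEllBridge.Iso H.ellBridge H.ellBridge, g.indexEquiv ≠ H.grpT.neg := by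
  classical
  haveI : NeZero l := ⟨(Fact.out : l.Prime).ne_zero⟩
  -- the translation `z ↦ z + 1` of `AGL₁(𝔽_l)`
  let φ₁ : Model.AGL l := ⟨Multiplicative.ofAdd 1, 1⟩
  have hφ₁ : ∀ z : ZMod l, Model.aglPerm l φ₁ z = z + 1 := fun z => by
    change ((1 : (ZMod l)ˣ) : ZMod l) * z + (Multiplicative.ofAdd (1 : ZMod l)).toAdd = z + 1
    simp
  let T : PMBaseKit.{0} l := PMBaseKit.toyKit l hl
  -- the toy kit at each of TWO places `𝕍 = Bool`, with `φ^{Θell}` the identity at `false`, `φ₁` at `true`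
  let K : PMBaseKit.{0} l :=
    { PMBaseKit.toyKit l hl with
      V := Bool
      decEqV := inferInstanceAs (DecidableEq Bool)
      bad := ∅
      arc := ∅
      Amb := fun _ => T.Amb ()
      catAmb := fun _ => T.catAmb ()
      model := fun _ => T.model ()
      pmObj := fun _ => T.pmObj ()
      toPM := fun _ => T.toPM ()
      LabCuspPM := fun _ => T.LabCuspPM ()
      labPM := fun _ => T.labPM ()
      labMap := fun _ => T.labMap ()
      labMap_refl := fun _ => T.labMap_refl ()
      labMap_trans := fun _ => T.labMap_trans ()
      labMap_charts := fun _ => T.labMap_charts ()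
      exists_negative := fun _ => T.exists_negative ()
      atV := fun _ => T.atV ()
      phiEll := fun v => bif v then φ₁ else T.phiEll ()
      labOfHom := fun _ => T.labOfHom ()
      labOfHom_pre := fun _ => T.labOfHom_pre ()
      labOfHom_post := fun _ => T.labOfHom_post ()
      labOfHom_phiEll_bijective := fun v => by
        cases v
        · exact T.labOfHom_phiEll_bijective ()
        · exact (Model.homPerm l (X := .loc) (Y := .glob) φ₁).bijective
      labOfHom_phiEll_charts := fun v => by
        cases v
        · exact T.labOfHom_phiEll_charts ()
        · rintro e ⟨ε, rfl⟩
          refine ⟨FlPM.mk (-(ε • (1 : ZMod l))) ε, ?_⟩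
          ext z
          change (FlPM.mk (l := l) _ ε) • z = ε • (Equiv.ofBijective _ _).symm z
          generalize hw : (Equiv.ofBijective _ _).symm z = w
          rw [Equiv.symm_apply_eq] at hw
          change z = Model.homPerm l (X := .loc) (Y := .glob) φ₁ w at hw
          have hw' : z = w + 1 := by rw [hw]; exact hφ₁ w
          subst hw'
          simp only [FlPM.mk_smul, smul_add]
          abel }
  have hV : Nonempty K.V := ⟨true⟩
  refine ⟨K, hV, Ex62.ht K, ?_⟩
  -- the underlying `𝒟-Θ^{ell}`-bridge of the model theater
  set B : K.DThetaEllBridge := (Ex62.ht K).ellBridge with hB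
  intro g hg
  -- notation and basic values in `K`
  have hchart : ∀ z : ZMod l, K.gChart₀ z = z := fun z => by
    change FlPM.toPerm l 1 z = z
    simp
  have hchart' : ∀ z : ZMod l, K.gChart₀.symm z = z := fun z => by
    rw [Equiv.symm_apply_eq]; exact (hchart z).symm
  -- what `φ^{Θell}_{•,v}` does on `±`-label classes of cusps, as a map `𝔽_l → 𝔽_l`
  let lab : K.V → ZMod l → ZMod l := fun v z => K.labOfHom v (K.phiEll v) z
  have hphi1 : ∀ z : ZMod l, lab true z = z + 1 := hφ₁
  have hphi0 : ∀ z : ZMod l, lab false z = z := fun z => by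
    change Model.aglPerm l 1 z = z
    rw [map_one]
    rfl
  have hneg : ∀ (v : K.V) (z : ZMod l), labNeg (K.isLocal_model v) z = -z := by
    intro v z
    obtain ⟨ε, hε⟩ : ∃ ε : ℤˣ, signPerm l ε = (K.labPM v (K.model v) (K.isLocal_model v)).chart₀ :=
      (K.labPM v (K.model v) (K.isLocal_model v)).chart₀_mem
    change ((K.labPM v (K.model v) (K.isLocal_model v)).chart₀.trans ((signPerm l (-1)).trans
      (K.labPM v (K.model v) (K.isLocal_model v)).chart₀.symm)) z = -z
    rw [← hε]
    change (signPerm l ε).symm (signPerm l (-1) (signPerm l ε z)) = -z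
    rw [Equiv.symm_apply_eq]
    simp [Units.smul_def, smul_neg]
  -- the induced bijections `ζ^{Θell}_{v_s}` of the model `𝒟-Θ^{ell}`-bridge
  have hζval : ∀ (s : ZMod l) (v : K.V) (ζ : K.LabCuspPM v ((B.capsule s).obj v) ≃ K.GLab B.glob),
      B.ZetaSpec s v ζ → ∀ z : ZMod l, ζ z = lab v z + s := by
    intro s v ζ hζ z
    obtain ⟨b, hb⟩ := Ex63.lifts_nonempty (K := K) (FlPM.transl s)
    have hf : K.phiEll v ≫ (K.atV v).map b.hom ∈ B.poly s v :=
      ⟨1, one_mem _, b, hb, by change _ = 𝟙 _ ≫ _; exact (Category.id_comp _).symm⟩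
    have h1 : K.labOfHom v (K.phiEll v ≫ (K.atV v).map b.hom) z = ζ z := congrFun (hζ.1 _ hf) z
    rw [K.labOfHom_post v (K.phiEll v) b] at h1
    rw [← h1]
    change K.gLabMap b (lab v z) = _
    rw [hb.2]
    simp only [Equiv.trans_apply, FlPM.toPerm_apply, FlPM.transl_smul, hchart, hchart']
  -- the index bijection of `g` is `t ↦ −t` (the negation of the tautological `𝔽_l^±`-group `𝔽_l`)
  have hκ : ∀ t : ZMod l, (g.indexEquiv t : ZMod l) = -t := fun t => by
    have h1 := Equiv.ext_iff.mp hg t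
    have h2 : signPerm l 1 ((FlPMGroup.tautological l).neg t) = -(signPerm l 1 t) :=
      (FlPMGroup.tautological l).chart_neg ⟨1, rfl⟩ t
    simp only [signPerm_apply, one_smul] at h2
    exact h1.trans h2
  -- Step 2 (abc-iut-L5-t7): read the compatibility square of `g` on `±`-label classes at `(0, true)`, `(1, false)`
  obtain ⟨ψ, hψ⟩ := g.globPoly_orbit
  have hψmem : ψ ∈ g.globPoly := by
    rw [hψ]
    exact ⟨1, one_mem _, (Iso.trans_refl _).symm⟩
  have key : ∀ (t : ZMod l) (v : K.V), K.gLabMap ψ (lab v 0 + t) = lab v 0 + -t := by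
    intro t v
    obtain ⟨φ, hφ⟩ := g.capsPoly_plusFull t
    obtain ⟨ζ₁, hζ₁⟩ := DThetaEllBridge.inducesZeta B t v
    obtain ⟨ζ₂, hζ₂⟩ := DThetaEllBridge.inducesZeta B (g.indexEquiv t) v
    -- the `v`-constituent of `φ`, viewed as an automorphism of the model `𝒟_v`
    let φv : K.model v ≅ K.model v := φ v
    have h : K.gLabMap ψ (ζ₁ (0 : ZMod l)) = ζ₂ (K.labMap v φv (0 : ZMod l)) :=
      DFunLike.congr_fun (DThetaEllBridge.Iso.zeta_trans_gLabMap g t v hφ hψmem hζ₁ hζ₂) (0 : ZMod l)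
    -- `φ_v` acts on `±`-label classes by `±1`, fixing the label `0`
    have h0 : K.labMap v φv (0 : ZMod l) = (0 : ZMod l) := by
      rcases labMap_eq_refl_or_labNeg (K.isLocal_model v) φv with hφv | hφv
      · rw [hφv]; rfl
      · rw [hφv, hneg, neg_zero]
    rw [hζval t v ζ₁ hζ₁ 0, h0, hζval (g.indexEquiv t) v ζ₂ hζ₂ 0, hκ t] at h
    exact h
  have k1 := key 0 true
  have k2 := key 1 false
  rw [hphi1, neg_zero, add_zero, zero_add] at k1
  rw [hphi0, zero_add, zero_add] at k2
  -- `ψ` maps the cusp `1` both to `1` and to `−1`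
  have h2 : (1 : ZMod l) = -1 := k1.symm.trans k2
  exact two_ne_zero_of_isLocal (K.isLocal_model true) (by linear_combination h2)

/-! ### F-2018 (ii): `DThetaEllBridge.IsoTorsor` — universal closure REFUTED, instance forms PROVED -/

/-- **[IUTchI] Prop 6.6 (ii) as typed is independent of the base interface** (explicit kit, universe `0`):
over abc-iut-L5-t7's two-place toy kit the underlying `𝒟-Θ^{ell}`-bridge `B` of the model theater violates
`DThetaEllBridge.IsoTorsor B B` — it would give that theater the `𝔽_l^{⋊±}`-symmetry of Prop 6.8 (i)
(`DThetaPMEllHT.ellBridgeSymmetry_of_isoTorsor`), which abc-iut-L5-t7 refuted there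
(`DThetaPMEllHT.exists_kit_not_ellBridgeSymmetry`). [claim: Mochizuki2012, status: disputed] -/
theorem DThetaEllBridge.exists_kit_not_isoTorsor (l : ℕ) [Fact l.Prime] (hl : l ≠ 2) :
    ∃ K : PMBaseKit.{0} l, Nonempty K.V ∧ ∃ B : K.DThetaEllBridge, ¬ DThetaEllBridge.IsoTorsor B B := by
  obtain ⟨K, hV, H, hH⟩ := DThetaPMEllHT.exists_kit_not_ellBridgeSymmetry l hl
  exact ⟨K, hV, H.ellBridge, fun h => hH (DThetaPMEllHT.ellBridgeSymmetry_of_isoTorsor H h)⟩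

/-- **F-2018 (ii), universal closure REFUTED.**  Prop 6.6 (ii) as typed (`DThetaEllBridge.IsoTorsor B₁ B₂`:
nonempty, and `g ↦` its index bijection is a bijection onto the isomorphisms of `𝔽_l^±`-torsors `T ⥲ T'`) is a
PREDICATE on abstract data `(K, B₁, B₂)`; its universal closure over the interface `PMBaseKit` is FALSE
(witness at `l = 3`, `B₁ = B₂`).  [claim: Mochizuki2012, status: disputed] -/
theorem DThetaEllBridge.not_forall_isoTorsor :
    ¬ ∀ (l : ℕ) (K : PMBaseKit.{0} l) (B₁ B₂ : K.DThetaEllBridge), DThetaEllBridge.IsoTorsor B₁ B₂ := by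
  intro h
  haveI : Fact (Nat.Prime 3) := ⟨Nat.prime_three⟩
  obtain ⟨K, -, B, hB⟩ := DThetaEllBridge.exists_kit_not_isoTorsor 3 (by decide)
  exact hB (h 3 K B B)

/-- **F-2018 (ii), instance form at the consistency MODEL — PROVED**: over abc-iut-L5-t4's `toyKit l hl`
(every interface clause genuine, `𝕍 = Unit`) Prop 6.6 (ii) holds for every pair of `𝒟-Θ^{ell}`-bridges, by
abc-iut-L5-t13's conditional discharge through the `[−1]`-compatibility of `φ^{Θell}_{•,v}`, which the model
has (`Ex63.negCompatModel_toyKit`). [claim: Mochizuki2012, status: disputed] -/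
theorem DThetaEllBridge.isoTorsor_toyKit (l : ℕ) [Fact l.Prime] (hl : l ≠ 2)
    (B₁ B₂ : (toyKit l hl).DThetaEllBridge) : DThetaEllBridge.IsoTorsor B₁ B₂ :=
  DThetaEllBridge.isoTorsor_of_negCompatModel (Ex63.negCompatModel_toyKit l hl) B₁ B₂

/-! ### F-2018 (iii): `DThetaPMEllHT.IsoTorsor` — universal closure REFUTED, instance forms PROVED -/

/-- **[IUTchI] Prop 6.6 (iii) as typed is independent of the base interface** (explicit kit, universe `0`):
over abc-iut-L5-t7's two-place toy kit the model `𝒟-Θ^{±ell}`-Hodge theater `H` violates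
`DThetaPMEllHT.IsoTorsor H H` — the negation `t ↦ −t` is an isomorphism of the `𝔽_l^±`-group `T`
(`FlPMGroup.neg_trans_mem`), an automorphism of `H` inducing it would have an underlying automorphism of the
`𝒟-Θ^{ell}`-bridge with the same index bijection (`DThetaPMEllHT.Iso.index_eq`), and there is none
(`DThetaPMEllHT.exists_kit_no_negative_ellIso`). [claim: Mochizuki2012, status: disputed] -/
theorem DThetaPMEllHT.exists_kit_not_isoTorsor (l : ℕ) [Fact l.Prime] (hl : l ≠ 2) :
    ∃ K : PMBaseKit.{0} l, Nonempty K.V ∧ ∃ H : K.DThetaPMEllHT, ¬ DThetaPMEllHT.IsoTorsor H H := by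
  obtain ⟨K, hV, H, hH⟩ := DThetaPMEllHT.exists_kit_no_negative_ellIso l hl
  refine ⟨K, hV, H, fun h => ?_⟩
  obtain ⟨-, hbij⟩ := h hV
  obtain ⟨g, hg⟩ := hbij.2 ⟨H.grpT.neg, fun e he => H.grpT.neg_trans_mem he⟩
  have h1 : g.pmIso.indexEquiv = H.grpT.neg := congrArg Subtype.val hg
  refine hH g.ellIso (Equiv.ext fun t => ?_)
  rw [← g.index_eq t, h1]
  exact rfl

/-- **F-2018 (iii), universal closure REFUTED.**  Prop 6.6 (iii) as typed (`DThetaPMEllHT.IsoTorsor H₁ H₂`: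
nonempty, and `g ↦` the index bijection of its `𝒟-Θ^±`-part is a bijection onto the isomorphisms of
`𝔽_l^±`-groups `T ⥲ T'`) is a PREDICATE on abstract data `(K, H₁, H₂)`; its universal closure over the interface
`PMBaseKit` is FALSE (witness at `l = 3`, `H₁ = H₂` the model theater). [claim: Mochizuki2012, status: disputed] -/
theorem DThetaPMEllHT.not_forall_isoTorsor :
    ¬ ∀ (l : ℕ) (K : PMBaseKit.{0} l) (H₁ H₂ : K.DThetaPMEllHT), DThetaPMEllHT.IsoTorsor H₁ H₂ := by
  intro h
  haveI : Fact (Nat.Prime 3) := ⟨Nat.prime_three⟩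
  obtain ⟨K, -, H, hH⟩ := DThetaPMEllHT.exists_kit_not_isoTorsor 3 (by decide)
  exact hH (h 3 K H H)

/-- **F-2018 (iii), instance form at the consistency MODEL — PROVED**: over abc-iut-L5-t4's `toyKit l hl`
Prop 6.6 (iii) holds for every pair of `𝒟-Θ^{±ell}`-Hodge theaters (abc-iut-L5-t13's conditional discharge,
`Ex63.negCompatModel_toyKit`). [claim: Mochizuki2012, status: disputed] -/
theorem DThetaPMEllHT.isoTorsor_toyKit (l : ℕ) [Fact l.Prime] (hl : l ≠ 2)
    (H₁ H₂ : (toyKit l hl).DThetaPMEllHT) : DThetaPMEllHT.IsoTorsor H₁ H₂ :=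
  DThetaPMEllHT.isoTorsor_of_negCompatModel (Ex63.negCompatModel_toyKit l hl) H₁ H₂

/-- **Prop 6.8 (i) at the consistency MODEL — PROVED** (for the record next to abc-iut-L5-t7's
`not_forall_ellBridgeSymmetry`): every `𝒟-Θ^{±ell}`-Hodge theater over `toyKit l hl` has the
`𝔽_l^{⋊±}`-symmetry. [claim: Mochizuki2012, status: disputed] -/
theorem DThetaPMEllHT.ellBridgeSymmetry_toyKit (l : ℕ) [Fact l.Prime] (hl : l ≠ 2)
    (H : (toyKit l hl).DThetaPMEllHT) : DThetaPMEllHT.EllBridgeSymmetry H :=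
  DThetaPMEllHT.ellBridgeSymmetry_of_negCompatModel (Ex63.negCompatModel_toyKit l hl) H

/-! ### F-2018: the kernel verdict for the row -/

/-- **F-2018, kernel verdict for the three declarations named `IsoTorsor`** ([IUTchI] Prop 6.6 (i), (ii), (iii)
p. 165): (i) the universal closure of `DThetaPMBridge.IsoTorsor` HOLDS (abc-iut-w5-d199); (ii), (iii) the
universal closures of `DThetaEllBridge.IsoTorsor` and `DThetaPMEllHT.IsoTorsor` are REFUTED over the
interface, while both hold CONDITIONALLY over abstract data under the `[−1]`-compatibility of `φ^{Theta ell}_{•,v}`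
(`Ex63.NegCompatModel K`, Example 6.3 (ii); abc-iut-L5-t13 / abc-iut-w5-d086) and UNCONDITIONALLY at the
consistency model `toyKit`.  Hence the row is a SCHEMA for (ii)/(iii): bind per kit under `Ex63.NegCompatModel K`
(as `layer5_held_sec6` does), never as a closed universal hypothesis. [claim: Mochizuki2012, status: disputed] -/
theorem isoTorsor_schema_verdict :
    (∀ (l : ℕ) (K : PMBaseKit.{u} l) (B₁ B₂ : K.DThetaPMBridge), DThetaPMBridge.IsoTorsor B₁ B₂) ∧
    (¬ ∀ (l : ℕ) (K : PMBaseKit.{0} l) (B₁ B₂ : K.DThetaEllBridge), DThetaEllBridge.IsoTorsor B₁ B₂) ∧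
    (¬ ∀ (l : ℕ) (K : PMBaseKit.{0} l) (H₁ H₂ : K.DThetaPMEllHT), DThetaPMEllHT.IsoTorsor H₁ H₂) ∧
    (∀ (l : ℕ) (K : PMBaseKit.{u} l), Ex63.NegCompatModel K →
      (∀ B₁ B₂ : K.DThetaEllBridge, DThetaEllBridge.IsoTorsor B₁ B₂) ∧
        ∀ H₁ H₂ : K.DThetaPMEllHT, DThetaPMEllHT.IsoTorsor H₁ H₂) ∧
    (∀ (l : ℕ) [Fact l.Prime] (hl : l ≠ 2),
      (∀ B₁ B₂ : (toyKit l hl).DThetaEllBridge, DThetaEllBridge.IsoTorsor B₁ B₂) ∧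
        ∀ H₁ H₂ : (toyKit l hl).DThetaPMEllHT, DThetaPMEllHT.IsoTorsor H₁ H₂) :=
  ⟨fun _ _ B₁ B₂ => DThetaPMBridge.isoTorsor B₁ B₂,
    DThetaEllBridge.not_forall_isoTorsor, DThetaPMEllHT.not_forall_isoTorsor,
    fun _ _ h => ⟨DThetaEllBridge.isoTorsor_of_negCompatModel h, DThetaPMEllHT.isoTorsor_of_negCompatModel h⟩,
    fun l _ hl => ⟨DThetaEllBridge.isoTorsor_toyKit l hl, DThetaPMEllHT.isoTorsor_toyKit l hl⟩⟩

end PMBaseKit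

end Literature.IUT.HodgeTheaters
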